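import Literature.MathematicalPhysics.QuantumFieldTheory.Balaban1983to89.B9Thm39CinvTorusRegular
import Literature.MathematicalPhysics.QuantumFieldTheory.Balaban1983to89.B9Thm39CinvFirstSum
import Literature.MathematicalPhysics.QuantumFieldTheory.Balaban1983to89.B9Thm39CinvSmallSums

/-!
# `Balaban1983to89.B9Thm39CinvSumsY` — [Balaban1985BackgroundPropagators] (3.95) p. 411: THE THREE SUMS OF `R` AT def-Y's LETTERS — FILE 1's displayed
# (2.85)-shape majorants `hR₁`, `hR₂`, `hR₃` DERIVED from the per-cube data (the localized (3.48) blocks of the `C_□`, the upper majorants of `Q′G′²Q′*`,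
# `Q′G′²_□Q′*`, the [2]-difference majorant, the slow variation of `h_□`, the separation of `supp(1 − □̃)` from `supp h_□`), by the first-sum estimate of
# FILE 2 and the second/third-sum estimates of FILE 5a read on def-Y's block carrier in real coordinates (cell `lit-balaban`, G-B9-LETTERS module M5.6
# FILE 5b, seat p21 gen 32)

statement-level skeleton of published theorems with citation tags; proofs where landed; nothing here is a claim about the Yang–Mills mass gap

CITATION HEADER (lean-in-tree rule).  B9 = T. Bałaban, *Propagators for lattice gauge theories in a background field*, Commun. Math. Phys. **99** (1985)
389–434 (journal page = PDF page + 388; held `paper:balaban1985-cmp99-background-propagators`, pp. 408–414 re-read by this seat 2026-08-28).  p. 411 (3.95)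
«Q′G′²Q′*C₀ = I + Σ_□(1 − □̃)Q′G′²Q′*h_□C_□h_□ + Σ_□ □̃Q′(G′² − G′²_□)Q′*h_□C_□h_□ + Σ_□[□̃Q′G′²_□Q′*, h_□]C_□h_□ = I − R.  By the same estimates as in [4],
especially (2.83)–(2.85), we can see that the operator R is small»; «The characteristic function 1 − □̃ at the beginning of the term, and the function h_□ at
the end, restrict a kernel of the term to points separated at least by a distance MLʲη (if □ ∈ 𝒟_j). Hence the part of the exponential factor can be
estimated by e^{−¼δ₀M}»; p. 412 (3.97) «the usual factors multiplied by e^{−2δ₀M}», «terms in the third sum … are already localized and give small factors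
O(M⁻¹)»; p. 408 «We take the partition of unity {h_□} … Σh²_□ = 1», defined «on 𝔅 also».  [4] = [Balaban1984PropagatorsII]: (2.51)–(2.54) pp. 232–233,
(2.60)–(2.61) p. 234, (2.83)–(2.85) pp. 237–238.  Rows B9.Eq3.95 × B9.Eq3.97 × B4.Eq2.83 × B4.Eq2.84 × B4.Eq2.85 (cells only; no row head changes).

WHY THIS FILE.  FILE 1 (`B9Thm39CinvTorusRegular.hasMajorant_conj_Cinv_of_cubes`) turns the per-cube (3.48) blocks `hC`, the local inverse property
`hloc`, `T·L = 1` and THREE DISPLAYED MAJORANTS `hR₁`, `hR₂`, `hR₃` of the three sums of (3.95) (read through `conj b` on the block carrier `BlkY i × ι`,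
block map `(s, j) ↦ ιB s`, cut-offs `Chi_□`, `M_{h_□} = cutMulY h_□`) into the (3.48)-shape majorant of `conj b (s•C(U))`.  FILES 2 and 5a proved the
three (2.83)/(2.84)/(3.97)-type estimates at a general block map for operators ALREADY in real coordinates (`mulOp χ * Lop * T`, …).  THIS FILE is the
dictionary in between: with `Chi_□ := cutMulY χ_□` (`χ_□ = 1` on the blocks of `□̃`, `0 ≦ χ_□ ≦ 1`) it rewrites `conj b` of each □-term of (3.95) as the
corresponding real-coordinate word — inserting the scale weights `s′` on the `Q′G′²Q′*`-type letters and `s` on the `C_□` (`s′s = 1`; print: `η⁴`, `η⁻⁴`)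
— and feeds FILES 2/5a with the per-cube displayed inputs, producing EXACTLY FILE 1's `hR₁`, `hR₂`, `hR₃` at the common rate `ρδ₀`.

WHAT IS PROVED (all `theorem`s, 0 `def`, 0 sorry, 0 new named facts).
* §1 algebra in real coordinates: `mulOp_one_sub`, `conj_term1` ((1 − Chi)·L·(M_hC_□M_h) ↦ `mulOp(1−χ)·conj(s′L)·(M_h·conj(sC_□)·M_h)`), `conj_term2`
  (□̃-term of the second sum), `conj_term3` (the commutator term of the third sum ↦ FILE 5a's word), `hasMajorant_hCh_local₂` (the two-sided localized
  majorant of `M_h·conj(sC_□)·M_h` from FILE 1's output-localized `hC`, r06's `hasMajorant_sandwich_local₂`).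
* §2 ★★ `hR₁_of_cubes` — FILE 1's `hR₁` with `θ₁ = N·κB₀Cc₁(δ₀, b−ρ)e^{−a_sepδ₀D_sep}` from: `hL` (`conj b (s′•L) ≺ κP⁻¹e^{−a_Lδ₀d}`, FILE 3b), `hC` (FILE 1's
  shape at rate `bδ₀`), separation `d(a, a″) ≧ D_sep` for `a ∉ S^χ_□`, `a″ ∈ S_□`, `χ_□ = 1` over `S^χ_□`, scale transfer, (2.61) at `b − ρ`,
  `α_st + a_sep + ρ ≦ a_L` (FILE 2 BY NAME).
* §3 ★★ `hR₂_of_cubes` — FILE 1's `hR₂` with `θ₂ = N·κ_De^{−2δ₀D_sep}B₀Cc₁(δ₀, b−ρ)` from the DISPLAYED [2]-difference majorants `hD` of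
  `conj b (s′•(L − L_□))` (GAP G-B9-05) and `hC` (FILE 5a `secondSum_majorant_blk` BY NAME).
* §4 ★★ `hR₃_of_cubes` — FILE 1's `hR₃` with `θ₃ = N·(ℓ₀ + ℓ₁(α_cδ₀)⁻¹)κB₀Cc₁(δ₀, b−ρ)` from `hLloc` (`conj b (s′•L_□) ≺ κP⁻¹e^{−a_Lδ₀d}`), `hC` and the slow
  variation `|h_□(t′) − h_□(t)| ≦ ℓ₀ + ℓ₁d(ιB t, ιB t′)` of the block cut-offs (FILE 5a `thirdSum_majorant_blk` BY NAME).

HONEST SCOPE.  Dictionary + bookkeeping; every analytic/geometric input is displayed in the printed shape and discharged elsewhere or located: `hL`/`hLloc`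
(M5.5 + FILES 3a/3b), `hC` (Cor. 3.6 for the cube letters `C_□` — M5.2-E), `hD` (the [2]-difference estimate — cell GAPS G-B9-05, NOT derived in the
tree), `hLip` (slow variation of `h_□` in the multiscale distance — GAPS G-pv08-1), `hsep` (the `MLʲη`-separation of `supp(1 − □̃)` from `supp h_□` in
`d` — the cube cover of record, F6), scale transfer / (2.61) / (2.54) / symmetry.  Rate bookkeeping is ONE admissible choice (common output rate `ρδ₀`);
constants explicit; nothing of [B9]/[4]/[2] asserted beyond what is proved; NOT summit progress.  RELATED, NOT DUPLICATED: FILE 2 / FILE 5a (the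
estimates, real-coordinate words), FILE 1 (the consumer), r06's `B9Thm39Whole` (scalar identity-block-map glue of the same three sums for the leaf
`B9.Thm39Printed`; different carrier, different consumer).
-/

noncomputable section

namespace Literature.MathematicalPhysics.QuantumFieldTheory.Balaban1983to89.B9Thm39CinvSumsY

open Node00
open B6KLevelCensusIndexV1 (KIdx)
open B6RandomWalk (HasMajorant hasMajorant_mono)
open B9Thm34Ext (toB6)
open B9GeoNormsKLevelV1 (geo9K)
open B9Eq352DivFormLetters (conj conj_sub conj_neg)
open B9Thm37Sum (mulOp mulOp_apply)
open B9Thm37CubeCoverCommutators (cutMulY)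
open B9Thm37GpTorusRegular (conj_one conj_sum conj_smul)
open B9Thm39CinvTorusRegular (conj_cutMulY)
open B9Thm39Sum (hasMajorant_sandwich_local₂)
open B9Ineq368PPrime (hasMajorant_neg)

variable {d ℓ : ℕ} {hd : 1 ≤ d + 1} {hL : Odd (ℓ + 1) ∧ 1 < ℓ + 1} {b₀ b₁ : ℝ}
variable {𝔸 : Type} [NormedRing 𝔸] [NormedAlgebra ℂ 𝔸] [CompleteSpace 𝔸]
variable {ι : Type} [Fintype ι]
variable (i : KIdx d ℓ hd hL b₀ b₁) (b : Module.Basis ι ℝ 𝔸)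

/-! ## §1 The □-terms of (3.95) in real coordinates, scale weights inserted -/

section Algebra

variable {S : Type}

/-- `mulOp (1 − f) = 1 − mulOp f` (the cut-off `1 − □̃` as a multiplication operator). [cite: Balaban1985BackgroundPropagators, (3.95) p.411, bookkeeping] -/
theorem mulOp_one_sub {X : Type} (f : X → ℝ) : mulOp (fun x => 1 - f x) = 1 - mulOp f := by
  apply LinearMap.ext
  intro μ
  funext x
  simp [mulOp_apply, sub_mul]

omit [CompleteSpace 𝔸] in
/-- scale weights on a product: `L·T = (s′•L)·(s•T)` for `s′s = 1`. [cite: Balaban1985BackgroundPropagators, (3.48) p.398 (the η-powers), bookkeeping] -/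
theorem mul_eq_smul_mul_smul {A : Type*} [Ring A] [Algebra ℝ A] {s s' : ℝ} (hs : s' * s = 1) (L T : A) : L * T = (s' • L) * (s • T) := by
  rw [smul_mul_smul_comm, hs, one_smul]

omit [CompleteSpace 𝔸] in
/-- the sandwich `M_h·C·M_h` with the scale weight moved to the middle: `s•(M_hCM_h) = M_h(s•C)M_h`, in real coordinates `M_h ↦ mulOp h`.
[cite: Balaban1985BackgroundPropagators, (3.87) p.409, bookkeeping] -/
theorem conj_smul_sandwich (s : ℝ) (h : S → ℝ) (C : Module.End ℝ (S → 𝔸)) :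
    conj b (s • ((cutMulY (𝔸 := 𝔸) h).restrictScalars ℝ * C * (cutMulY (𝔸 := 𝔸) h).restrictScalars ℝ)) =
      mulOp (fun p : S × ι => h p.1) * conj b (s • C) * mulOp (fun p : S × ι => h p.1) := by
  rw [show s • ((cutMulY (𝔸 := 𝔸) h).restrictScalars ℝ * C * (cutMulY (𝔸 := 𝔸) h).restrictScalars ℝ) =
      (cutMulY (𝔸 := 𝔸) h).restrictScalars ℝ * (s • C) * (cutMulY (𝔸 := 𝔸) h).restrictScalars ℝ by
    rw [mul_smul_comm, smul_mul_assoc]]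
  rw [B9Eq352DivFormLetters.conj_mul, B9Eq352DivFormLetters.conj_mul, conj_cutMulY]

omit [CompleteSpace 𝔸] in
/-- **the □-term of the FIRST sum in real coordinates**: with `Chi = cutMulY χ`, `M_h = cutMulY h`, `s′s = 1`:
`conj b ((1 − Chi)·L·(M_hC_□M_h)) = mulOp(1 − χ)·conj b (s′•L)·(mulOp h·conj b (s•C_□)·mulOp h)` — FILE 2's word `mulOp χc * Lop * T`.
[cite: Balaban1985BackgroundPropagators, (3.95) p.411 (first sum)] -/
theorem conj_term1 {s s' : ℝ} (hs : s' * s = 1) (χ h : S → ℝ) (L C : Module.End ℝ (S → 𝔸)) :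
    conj b ((1 - (cutMulY (𝔸 := 𝔸) χ).restrictScalars ℝ) * L *
        ((cutMulY (𝔸 := 𝔸) h).restrictScalars ℝ * C * (cutMulY (𝔸 := 𝔸) h).restrictScalars ℝ)) =
      mulOp (fun p : S × ι => 1 - χ p.1) * conj b (s' • L) *
        (mulOp (fun p : S × ι => h p.1) * conj b (s • C) * mulOp (fun p : S × ι => h p.1)) := by
  rw [mul_assoc, mul_eq_smul_mul_smul hs L, ← mul_assoc, B9Eq352DivFormLetters.conj_mul, B9Eq352DivFormLetters.conj_mul, conj_sub, conj_one,
    conj_cutMulY, conj_smul_sandwich, mulOp_one_sub]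

omit [CompleteSpace 𝔸] in
/-- **the □-term of the SECOND sum in real coordinates**: `conj b (Chi·(L − L_□)·(M_hC_□M_h)) = mulOp χ·conj b (s′•(L − L_□))·(mulOp h·conj b (s•C_□)·mulOp h)`
— FILE 5a's word `mulOp χ * D * (mulOp h * Cl * mulOp h)`. [cite: Balaban1985BackgroundPropagators, (3.95) p.411 (second sum), (3.97) p.412] -/
theorem conj_term2 {s s' : ℝ} (hs : s' * s = 1) (χ h : S → ℝ) (D C : Module.End ℝ (S → 𝔸)) :
    conj b ((cutMulY (𝔸 := 𝔸) χ).restrictScalars ℝ * D *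
        ((cutMulY (𝔸 := 𝔸) h).restrictScalars ℝ * C * (cutMulY (𝔸 := 𝔸) h).restrictScalars ℝ)) =
      mulOp (fun p : S × ι => χ p.1) * conj b (s' • D) *
        (mulOp (fun p : S × ι => h p.1) * conj b (s • C) * mulOp (fun p : S × ι => h p.1)) := by
  rw [mul_assoc, mul_eq_smul_mul_smul hs D, ← mul_assoc, B9Eq352DivFormLetters.conj_mul, B9Eq352DivFormLetters.conj_mul, conj_cutMulY,
    conj_smul_sandwich]

omit [CompleteSpace 𝔸] in
/-- **the □-term of the THIRD sum in real coordinates**: `conj b ((Chi·L_□·M_h − M_h·(Chi·L_□))·C_□·M_h) = (mulOp χ·conj b (s′•L_□)·mulOp h −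
mulOp h·(mulOp χ·conj b (s′•L_□)))·conj b (s•C_□)·mulOp h` — FILE 5a's word. [cite: Balaban1985BackgroundPropagators, (3.95) p.411 (third sum)] -/
theorem conj_term3 {s s' : ℝ} (hs : s' * s = 1) (χ h : S → ℝ) (Lloc C : Module.End ℝ (S → 𝔸)) :
    conj b (((cutMulY (𝔸 := 𝔸) χ).restrictScalars ℝ * Lloc * (cutMulY (𝔸 := 𝔸) h).restrictScalars ℝ -
        (cutMulY (𝔸 := 𝔸) h).restrictScalars ℝ * ((cutMulY (𝔸 := 𝔸) χ).restrictScalars ℝ * Lloc)) * C *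
        (cutMulY (𝔸 := 𝔸) h).restrictScalars ℝ) =
      (mulOp (fun p : S × ι => χ p.1) * conj b (s' • Lloc) * mulOp (fun p : S × ι => h p.1) -
        mulOp (fun p : S × ι => h p.1) * (mulOp (fun p : S × ι => χ p.1) * conj b (s' • Lloc))) * conj b (s • C) *
        mulOp (fun p : S × ι => h p.1) := by
  have hrw : ((cutMulY (𝔸 := 𝔸) χ).restrictScalars ℝ * Lloc * (cutMulY (𝔸 := 𝔸) h).restrictScalars ℝ -
        (cutMulY (𝔸 := 𝔸) h).restrictScalars ℝ * ((cutMulY (𝔸 := 𝔸) χ).restrictScalars ℝ * Lloc)) * C =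
      ((cutMulY (𝔸 := 𝔸) χ).restrictScalars ℝ * (s' • Lloc) * (cutMulY (𝔸 := 𝔸) h).restrictScalars ℝ -
        (cutMulY (𝔸 := 𝔸) h).restrictScalars ℝ * ((cutMulY (𝔸 := 𝔸) χ).restrictScalars ℝ * (s' • Lloc))) * (s • C) := by
    have h1 : (cutMulY (𝔸 := 𝔸) χ).restrictScalars ℝ * (s' • Lloc) * (cutMulY (𝔸 := 𝔸) h).restrictScalars ℝ =
        s' • ((cutMulY (𝔸 := 𝔸) χ).restrictScalars ℝ * Lloc * (cutMulY (𝔸 := 𝔸) h).restrictScalars ℝ) := by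
      rw [mul_smul_comm, smul_mul_assoc]
    have h2 : (cutMulY (𝔸 := 𝔸) h).restrictScalars ℝ * ((cutMulY (𝔸 := 𝔸) χ).restrictScalars ℝ * (s' • Lloc)) =
        s' • ((cutMulY (𝔸 := 𝔸) h).restrictScalars ℝ * ((cutMulY (𝔸 := 𝔸) χ).restrictScalars ℝ * Lloc)) := by
      rw [mul_smul_comm, mul_smul_comm]
    rw [h1, h2, (smul_sub s' ((cutMulY (𝔸 := 𝔸) χ).restrictScalars ℝ * Lloc * (cutMulY (𝔸 := 𝔸) h).restrictScalars ℝ)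
      ((cutMulY (𝔸 := 𝔸) h).restrictScalars ℝ * ((cutMulY (𝔸 := 𝔸) χ).restrictScalars ℝ * Lloc))).symm, smul_mul_smul_comm, hs, one_smul]
  rw [hrw, B9Eq352DivFormLetters.conj_mul, B9Eq352DivFormLetters.conj_mul, conj_sub, B9Eq352DivFormLetters.conj_mul, B9Eq352DivFormLetters.conj_mul,
    B9Eq352DivFormLetters.conj_mul, B9Eq352DivFormLetters.conj_mul, conj_cutMulY, conj_cutMulY]

end Algebra

/-! ## §1b The two-sided localized majorant of `M_h·conj b (s•C_□)·M_h` from FILE 1's `hC` -/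

section Local

variable [DecidableEq ι] [Fintype (geo9K i).Site] [DecidableEq (geo9K i).Site] {Rr : ℝ} {Hp : Prop}
variable (ιB : BlkY i → IBondY i)

omit [CompleteSpace 𝔸] [DecidableEq ι] [Fintype ι] in
/-- from FILE 1's output-localized (3.48) block `1_{S_□}(a)·B₀P(a)e^{−r d}` of `conj b (s•C_□)` to the TWO-SIDED localized majorant
`1_{S_□}(a)1_{S_□}(a′)·B₀P(a)e^{−r d}` of `M_{h_□}·conj b (s•C_□)·M_{h_□}` (`|h_□| ≦ 1`, `supp h_□ ⊂ S_□` through `ιB`; r06's `hasMajorant_sandwich_local₂`).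
[cite: Balaban1985BackgroundPropagators, (3.87) p.409 + (3.95) p.411; Balaban1984PropagatorsII, (2.51) p.232] -/
theorem hasMajorant_hCh_local₂ (S : Finset (geo9K i).Site) (h : BlkY i → ℝ) {Cc : Module.End ℝ (BlkY i × ι → ℝ)} {B₀ r : ℝ}
    (P : (geo9K i).Site → ℝ) (hB₀ : 0 ≤ B₀) (hP : ∀ a, 0 ≤ P a)
    (hh : ∀ t, |h t| ≤ 1) (hS : ∀ t, h t ≠ 0 → ιB t ∈ S)
    (hC : HasMajorant (g := toB6 (geo9K i) Rr Hp) (fun p : BlkY i × ι => ιB p.1) Cc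
      (fun a a' => if a ∈ S then B₀ * P a * Real.exp (-(r * (geo9K i).dist a a')) else 0)) :
    HasMajorant (g := toB6 (geo9K i) Rr Hp) (fun p : BlkY i × ι => ιB p.1)
      (mulOp (fun p : BlkY i × ι => h p.1) * Cc * mulOp (fun p : BlkY i × ι => h p.1))
      (fun a a' => (if a ∈ S then (1 : ℝ) else 0) * (if a' ∈ S then (1 : ℝ) else 0) *
        (B₀ * P a * Real.exp (-(r * (geo9K i).dist a a')))) := by
  refine hasMajorant_mono (g := toB6 (geo9K i) Rr Hp) _
    (hasMajorant_sandwich_local₂ (R := Rr) (H := Hp) (fun p : BlkY i × ι => ιB p.1) hC (fun p => h p.1) (fun p => hh p.1) S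
      (fun p hp => hS p.1 hp)) fun a a' => ?_
  refine mul_le_mul_of_nonneg_left ?_ (mul_nonneg (by split_ifs <;> norm_num) (by split_ifs <;> norm_num))
  split_ifs
  · exact le_rfl
  · exact mul_nonneg (mul_nonneg hB₀ (hP a)) (Real.exp_nonneg _)

end Local

/-! ## §2 ★★ The FIRST sum of (3.95): FILE 1's `hR₁` from `hL`, `hC`, the separation and FILE 2 -/

section Sums

variable [DecidableEq ι] [Fintype (geo9K i).Site] [DecidableEq (geo9K i).Site] {Rr : ℝ} {Hp : Prop}
variable (ιB : BlkY i → IBondY i)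

omit [CompleteSpace 𝔸] [DecidableEq ι] in
/-- ★★ **THE FIRST SUM OF (3.95) IS (2.85)-SMALL — FILE 1's `hR₁`** («The characteristic function 1 − □̃ at the beginning of the term, and the function h_□
at the end, restrict a kernel of the term to points separated at least by a distance MLʲη … estimated by e^{−¼δ₀M}»): with the cut-offs `χ_□`
(`0 ≦ χ_□ ≦ 1`, `χ_□ = 1` over `S^χ_□`), `h_□` (`|h_□| ≦ 1`, `supp h_□ ⊂ S_□`, overlap `≦ N`), the upper majorant `hL` of `conj b (s′•L)` (`κP⁻¹e^{−a_Lδ₀d}`), the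
localized (3.48) blocks `hC` of `conj b (s•C_□)` (`1_{S_□}B₀Pe^{−bδ₀d}`), `s′s = 1`, the separation `d(a, a″) ≧ D_sep` (`a ∉ S^χ_□`, `a″ ∈ S_□`), scale
transfer at `α_st`, (2.61) at `b − ρ`, `α_st + a_sep + ρ ≦ a_L`:  `conj b (−Σ_□(1 − Chi_□)·L·(M_{h_□}C_□M_{h_□}))` has the majorant `θ₁·e^{−ρδ₀d(a,a′)}`,
`θ₁ = N·κB₀Cc₁(δ₀, b−ρ)e^{−a_sepδ₀D_sep}`. [cite: Balaban1985BackgroundPropagators, (3.95) p.411; Balaban1984PropagatorsII, (2.83)–(2.85) pp.237–238] -/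
theorem hR₁_of_cubes (d' : ℕ) {δ₀ aL αst asep ρ bb κ B₀ C Dsep N s s' : ℝ} (P : (geo9K i).Site → ℝ)
    {κι : Type} [Fintype κι] (Sχ S : κι → Finset (geo9K i).Site) (χ h : κι → BlkY i → ℝ)
    {L : Module.End ℝ (BlkY i → 𝔸)} (Cl : κι → Module.End ℝ (BlkY i → 𝔸))
    (hs : s' * s = 1) (hκ : 0 ≤ κ) (hB₀ : 0 ≤ B₀) (hC0 : 0 ≤ C) (hP : ∀ a, 0 < P a) (hδ₀ : 0 ≤ δ₀)
    (hasep : 0 ≤ asep) (hρ : 0 ≤ ρ) (hsplit : αst + asep + ρ ≤ aL)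
    (htri : B6RandomWalk.Triangle254 (toB6 (geo9K i) Rr Hp)) (hsymm : ∀ a a' : (geo9K i).Site, (geo9K i).dist a a' = (geo9K i).dist a' a)
    (hdnn : ∀ a a' : (geo9K i).Site, 0 ≤ (geo9K i).dist a a')
    (hST : B9Ineq347.ScaleTransfer (geo9K i) δ₀ αst C P) (h261 : B6RandomWalk.Ineq261 d' (toB6 (geo9K i) Rr Hp) δ₀ (bb - ρ))
    (hχ01 : ∀ k t, 0 ≤ χ k t ∧ χ k t ≤ 1) (hχS : ∀ k t, ιB t ∈ Sχ k → χ k t = 1)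
    (hh : ∀ k t, |h k t| ≤ 1) (hS : ∀ k t, h k t ≠ 0 → ιB t ∈ S k)
    (hsep : ∀ k a, a ∉ Sχ k → ∀ a'' ∈ S k, Dsep ≤ (geo9K i).dist a a'')
    (hcnt : ∀ a : (geo9K i).Site, (∑ k, if a ∈ S k then (1 : ℝ) else 0) ≤ N)
    (hLmaj : HasMajorant (g := toB6 (geo9K i) Rr Hp) (fun p : BlkY i × ι => ιB p.1) (conj b (s' • L))
      (fun a a'' => κ * (P a)⁻¹ * Real.exp (-(aL * δ₀ * (geo9K i).dist a a''))))
    (hC : ∀ k, HasMajorant (g := toB6 (geo9K i) Rr Hp) (fun p : BlkY i × ι => ιB p.1) (conj b (s • Cl k))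
      (fun a a' => if a ∈ S k then B₀ * P a * Real.exp (-(bb * δ₀ * (geo9K i).dist a a')) else 0)) :
    HasMajorant (g := toB6 (geo9K i) Rr Hp) (fun p : BlkY i × ι => ιB p.1)
      (conj b (-(∑ k, (1 - (cutMulY (𝔸 := 𝔸) (χ k)).restrictScalars ℝ) * L *
        ((cutMulY (𝔸 := 𝔸) (h k)).restrictScalars ℝ * Cl k * (cutMulY (𝔸 := 𝔸) (h k)).restrictScalars ℝ))))
      (fun a a' => (N * (κ * B₀ * C * B6.c1 d' δ₀ (bb - ρ) * Real.exp (-(asep * δ₀ * Dsep)))) *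
        Real.exp (-(ρ * δ₀ * (geo9K i).dist a a'))) := by
  rw [conj_neg]
  refine hasMajorant_neg (g := geo9K i) (R := Rr) (H := Hp) _ ?_
  rw [conj_sum]
  have hterm : ∀ k, conj b ((1 - (cutMulY (𝔸 := 𝔸) (χ k)).restrictScalars ℝ) * L *
      ((cutMulY (𝔸 := 𝔸) (h k)).restrictScalars ℝ * Cl k * (cutMulY (𝔸 := 𝔸) (h k)).restrictScalars ℝ)) =
      mulOp (fun p : BlkY i × ι => 1 - χ k p.1) * conj b (s' • L) *
        (mulOp (fun p : BlkY i × ι => h k p.1) * conj b (s • Cl k) * mulOp (fun p : BlkY i × ι => h k p.1)) :=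
    fun k => conj_term1 b hs (χ k) (h k) L (Cl k)
  rw [Finset.sum_congr rfl fun k _ => hterm k]
  have hT : ∀ k, HasMajorant (g := toB6 (geo9K i) Rr Hp) (fun p : BlkY i × ι => ιB p.1)
      (mulOp (fun p : BlkY i × ι => h k p.1) * conj b (s • Cl k) * mulOp (fun p : BlkY i × ι => h k p.1))
      (fun a'' a' => (if a'' ∈ S k then (1 : ℝ) else 0) * (if a' ∈ S k then (1 : ℝ) else 0) *
        (B₀ * P a'' * Real.exp (-(bb * δ₀ * (geo9K i).dist a'' a')))) := fun k =>
    hasMajorant_hCh_local₂ i ιB (S k) (h k) P hB₀ (fun a => (hP a).le) (hh k) (hS k) (hC k)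
  refine hasMajorant_mono (g := toB6 (geo9K i) Rr Hp) _
    (B9Thm39CinvFirstSum.firstSum_majorant_blk (g := geo9K i) (X := BlkY i × ι) (R := Rr) (H := Hp) (fun p : BlkY i × ι => ιB p.1) ρ δ₀
      (κ * B₀ * C * B6.c1 d' δ₀ (bb - ρ) * Real.exp (-(asep * δ₀ * Dsep))) N Sχ S
      (fun k => mulOp (fun p : BlkY i × ι => 1 - χ k p.1) * conj b (s' • L) *
        (mulOp (fun p : BlkY i × ι => h k p.1) * conj b (s • Cl k) * mulOp (fun p : BlkY i × ι => h k p.1)))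
      (mul_nonneg (mul_nonneg (mul_nonneg (mul_nonneg hκ hB₀) hC0) (B6RandomWalk.c1_nonneg d' δ₀ _)) (Real.exp_nonneg _))
      (fun k => ?_) hcnt) fun a a' => le_of_eq (by ring)
  exact B9Thm39CinvFirstSum.firstSum_term_majorant_blk (g := geo9K i) (X := BlkY i × ι) (R := Rr) (H := Hp) (fun p : BlkY i × ι => ιB p.1) d' δ₀ aL αst asep ρ bb κ B₀ C Dsep P
    (Sχ k) (S k) (fun p : BlkY i × ι => 1 - χ k p.1) hκ hB₀ hC0 hP hδ₀ hasep hρ hsplit htri hsymm hdnn hST h261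
    (fun p => by
      obtain ⟨h0, h1⟩ := hχ01 k p.1
      rw [abs_le]; constructor <;> linarith)
    (fun p hp => by rw [hχS k p.1 hp, sub_self]) (hsep k) hLmaj (hT k)

/-! ## §3 ★★ The SECOND sum of (3.95): FILE 1's `hR₂` from the displayed [2]-difference majorants, `hC` and FILE 5a -/

omit [CompleteSpace 𝔸] [DecidableEq ι] in
/-- ★★ **THE SECOND SUM OF (3.95) IS (2.85)-SMALL — FILE 1's `hR₂`** ((3.97): «the usual factors multiplied by e^{−2δ₀M} … estimated by (2δ₀M)⁻¹»): with
the DISPLAYED [2]-difference majorants `hD` of `conj b (s′•(L − L_□))` (`κ_De^{−2δ₀D_sep}P⁻¹e^{−a_Dδ₀d}`; cell GAPS G-B9-05), the localized (3.48) blocks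
`hC`, the cut-offs (`|χ_□| ≦ 1`, `|h_□| ≦ 1`, `supp h_□ ⊂ S_□`, overlap `≦ N`), `s′s = 1`, scale transfer, (2.61) at `b − ρ`, `α_st + ρ ≦ a_D`:
`conj b (−Σ_□ Chi_□·(L − L_□)·(M_{h_□}C_□M_{h_□}))` has the majorant `θ₂·e^{−ρδ₀d}`, `θ₂ = N·κ_De^{−2δ₀D_sep}B₀Cc₁(δ₀, b−ρ)`.
[cite: Balaban1985BackgroundPropagators, (3.95) p.411 + (3.97) p.412; Balaban1984PropagatorsII, (2.85) p.238] -/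
theorem hR₂_of_cubes (d' : ℕ) {δ₀ aD αst ρ bb κD Dsep B₀ C N s s' : ℝ} (P : (geo9K i).Site → ℝ)
    {κι : Type} [Fintype κι] (S : κι → Finset (geo9K i).Site) (χ h : κι → BlkY i → ℝ)
    {L : Module.End ℝ (BlkY i → 𝔸)} (Lloc Cl : κι → Module.End ℝ (BlkY i → 𝔸))
    (hs : s' * s = 1) (hκD : 0 ≤ κD) (hB₀ : 0 ≤ B₀) (hC0 : 0 ≤ C) (hP : ∀ a, 0 < P a) (hδ₀ : 0 ≤ δ₀) (hρ : 0 ≤ ρ) (hsplit : αst + ρ ≤ aD)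
    (htri : B6RandomWalk.Triangle254 (toB6 (geo9K i) Rr Hp)) (hsymm : ∀ a a' : (geo9K i).Site, (geo9K i).dist a a' = (geo9K i).dist a' a)
    (hdnn : ∀ a a' : (geo9K i).Site, 0 ≤ (geo9K i).dist a a')
    (hST : B9Ineq347.ScaleTransfer (geo9K i) δ₀ αst C P) (h261 : B6RandomWalk.Ineq261 d' (toB6 (geo9K i) Rr Hp) δ₀ (bb - ρ))
    (hχ1 : ∀ k t, |χ k t| ≤ 1) (hh : ∀ k t, |h k t| ≤ 1) (hS : ∀ k t, h k t ≠ 0 → ιB t ∈ S k)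
    (hcnt : ∀ a : (geo9K i).Site, (∑ k, if a ∈ S k then (1 : ℝ) else 0) ≤ N)
    (hD : ∀ k, HasMajorant (g := toB6 (geo9K i) Rr Hp) (fun p : BlkY i × ι => ιB p.1) (conj b (s' • (L - Lloc k)))
      (fun a a'' => κD * Real.exp (-(2 * δ₀ * Dsep)) * (P a)⁻¹ * Real.exp (-(aD * δ₀ * (geo9K i).dist a a''))))
    (hC : ∀ k, HasMajorant (g := toB6 (geo9K i) Rr Hp) (fun p : BlkY i × ι => ιB p.1) (conj b (s • Cl k))
      (fun a a' => if a ∈ S k then B₀ * P a * Real.exp (-(bb * δ₀ * (geo9K i).dist a a')) else 0)) :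
    HasMajorant (g := toB6 (geo9K i) Rr Hp) (fun p : BlkY i × ι => ιB p.1)
      (conj b (-(∑ k, (cutMulY (𝔸 := 𝔸) (χ k)).restrictScalars ℝ * (L - Lloc k) *
        ((cutMulY (𝔸 := 𝔸) (h k)).restrictScalars ℝ * Cl k * (cutMulY (𝔸 := 𝔸) (h k)).restrictScalars ℝ))))
      (fun a a' => (N * (κD * Real.exp (-(2 * δ₀ * Dsep)) * B₀ * C * B6.c1 d' δ₀ (bb - ρ))) *
        Real.exp (-(ρ * δ₀ * (geo9K i).dist a a'))) := by
  rw [conj_neg]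
  refine hasMajorant_neg (g := geo9K i) (R := Rr) (H := Hp) _ ?_
  rw [conj_sum]
  have hterm : ∀ k, conj b ((cutMulY (𝔸 := 𝔸) (χ k)).restrictScalars ℝ * (L - Lloc k) *
      ((cutMulY (𝔸 := 𝔸) (h k)).restrictScalars ℝ * Cl k * (cutMulY (𝔸 := 𝔸) (h k)).restrictScalars ℝ)) =
      mulOp (fun p : BlkY i × ι => χ k p.1) * conj b (s' • (L - Lloc k)) *
        (mulOp (fun p : BlkY i × ι => h k p.1) * conj b (s • Cl k) * mulOp (fun p : BlkY i × ι => h k p.1)) :=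
    fun k => conj_term2 b hs (χ k) (h k) (L - Lloc k) (Cl k)
  rw [Finset.sum_congr rfl fun k _ => hterm k]
  -- the un-localized (3.48) majorant of `conj b (s•C_□)` (FILE 5a's `hCl` shape) from FILE 1's localized one
  have hCl : ∀ k, HasMajorant (g := toB6 (geo9K i) Rr Hp) (fun p : BlkY i × ι => ιB p.1) (conj b (s • Cl k))
      (fun a'' a' => B₀ * P a'' * Real.exp (-(bb * δ₀ * (geo9K i).dist a'' a'))) := fun k =>
    hasMajorant_mono (g := toB6 (geo9K i) Rr Hp) _ (hC k) fun a a' => by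
      split_ifs
      · exact le_rfl
      · exact mul_nonneg (mul_nonneg hB₀ (hP a).le) (Real.exp_nonneg _)
  have h5a := B9Thm39CinvSmallSums.secondSum_majorant_blk (g := geo9K i) (X := BlkY i × ι) (R := Rr) (H := Hp) (fun p : BlkY i × ι => ιB p.1) d' δ₀ aD αst ρ bb κD Dsep B₀ C N P S
    (fun k (p : BlkY i × ι) => χ k p.1) (fun k (p : BlkY i × ι) => h k p.1) hκD hB₀ hC0 hP hδ₀ hρ hsplit htri hsymm hdnn hST h261
    (fun k p => hχ1 k p.1) (fun k p => hh k p.1) (fun k p hp => hS k p.1 hp) hcnt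
    (fun k => conj b (s' • (L - Lloc k))) (fun k => conj b (s • Cl k)) hD hCl
  exact hasMajorant_mono (g := toB6 (geo9K i) Rr Hp) _ h5a fun a a' => le_of_eq (by ring)

/-! ## §4 ★★ The THIRD sum of (3.95): FILE 1's `hR₃` from `hLloc`, `hC`, the slow variation of `h_□` and FILE 5a -/

omit [CompleteSpace 𝔸] [DecidableEq ι] in
/-- ★★ **THE THIRD SUM OF (3.95) IS (2.85)-SMALL — FILE 1's `hR₃`** («terms in the third sum … are already localized and give small factors O(M⁻¹)»): with
the upper majorants `hLloc` of `conj b (s′•L_□)` (`κP⁻¹e^{−a_Lδ₀d}`), the localized (3.48) blocks `hC`, the cut-offs (`|χ_□| ≦ 1`, `|h_□| ≦ 1`,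
`supp h_□ ⊂ S_□`, overlap `≦ N`), the SLOW VARIATION of the block cut-offs `|h_□(t′) − h_□(t)| ≦ ℓ₀ + ℓ₁d(ιB t, ιB t′)` (`hLip`; `ℓ₀, ℓ₁ = O(M⁻¹)` in print),
`s′s = 1`, scale transfer, (2.61) at `b − ρ`, `α_st + α_c + ρ ≦ a_L`, `α_cδ₀ > 0`:  `conj b (−Σ_□(Chi_□L_□M_{h_□} − M_{h_□}Chi_□L_□)·C_□·M_{h_□})` has the
majorant `θ₃·e^{−ρδ₀d}`, `θ₃ = N·(ℓ₀ + ℓ₁(α_cδ₀)⁻¹)κB₀Cc₁(δ₀, b−ρ)`. [cite: Balaban1985BackgroundPropagators, (3.95) p.411 + p.412; Balaban1984PropagatorsII, (2.84)–(2.85) p.238] -/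
theorem hR₃_of_cubes (d' : ℕ) {δ₀ aL αc αst ρ bb κ ℓ₀ ℓ₁ B₀ C N s s' : ℝ} (P : (geo9K i).Site → ℝ)
    {κι : Type} [Fintype κι] (S : κι → Finset (geo9K i).Site) (χ h : κι → BlkY i → ℝ)
    (Lloc Cl : κι → Module.End ℝ (BlkY i → 𝔸))
    (hs : s' * s = 1) (hκ : 0 ≤ κ) (hℓ₀ : 0 ≤ ℓ₀) (hℓ₁ : 0 ≤ ℓ₁) (hB₀ : 0 ≤ B₀) (hC0 : 0 ≤ C) (hP : ∀ a, 0 < P a) (hδ₀ : 0 ≤ δ₀)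
    (hαc : 0 < αc * δ₀) (hρ : 0 ≤ ρ) (hsplit : αst + αc + ρ ≤ aL)
    (htri : B6RandomWalk.Triangle254 (toB6 (geo9K i) Rr Hp)) (hsymm : ∀ a a' : (geo9K i).Site, (geo9K i).dist a a' = (geo9K i).dist a' a)
    (hdnn : ∀ a a' : (geo9K i).Site, 0 ≤ (geo9K i).dist a a')
    (hST : B9Ineq347.ScaleTransfer (geo9K i) δ₀ αst C P) (h261 : B6RandomWalk.Ineq261 d' (toB6 (geo9K i) Rr Hp) δ₀ (bb - ρ))
    (hχ1 : ∀ k t, |χ k t| ≤ 1) (hh : ∀ k t, |h k t| ≤ 1) (hS : ∀ k t, h k t ≠ 0 → ιB t ∈ S k)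
    (hLip : ∀ k (t t' : BlkY i), |h k t' - h k t| ≤ ℓ₀ + ℓ₁ * (geo9K i).dist (ιB t) (ιB t'))
    (hcnt : ∀ a : (geo9K i).Site, (∑ k, if a ∈ S k then (1 : ℝ) else 0) ≤ N)
    (hLloc : ∀ k, HasMajorant (g := toB6 (geo9K i) Rr Hp) (fun p : BlkY i × ι => ιB p.1) (conj b (s' • Lloc k))
      (fun a a'' => κ * (P a)⁻¹ * Real.exp (-(aL * δ₀ * (geo9K i).dist a a''))))
    (hC : ∀ k, HasMajorant (g := toB6 (geo9K i) Rr Hp) (fun p : BlkY i × ι => ιB p.1) (conj b (s • Cl k))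
      (fun a a' => if a ∈ S k then B₀ * P a * Real.exp (-(bb * δ₀ * (geo9K i).dist a a')) else 0)) :
    HasMajorant (g := toB6 (geo9K i) Rr Hp) (fun p : BlkY i × ι => ιB p.1)
      (conj b (-(∑ k, ((cutMulY (𝔸 := 𝔸) (χ k)).restrictScalars ℝ * Lloc k * (cutMulY (𝔸 := 𝔸) (h k)).restrictScalars ℝ -
        (cutMulY (𝔸 := 𝔸) (h k)).restrictScalars ℝ * ((cutMulY (𝔸 := 𝔸) (χ k)).restrictScalars ℝ * Lloc k)) * Cl k *
        (cutMulY (𝔸 := 𝔸) (h k)).restrictScalars ℝ)))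
      (fun a a' => (N * ((ℓ₀ + ℓ₁ * (αc * δ₀)⁻¹) * κ * B₀ * C * B6.c1 d' δ₀ (bb - ρ))) *
        Real.exp (-(ρ * δ₀ * (geo9K i).dist a a'))) := by
  rw [conj_neg]
  refine hasMajorant_neg (g := geo9K i) (R := Rr) (H := Hp) _ ?_
  rw [conj_sum]
  have hterm : ∀ k, conj b (((cutMulY (𝔸 := 𝔸) (χ k)).restrictScalars ℝ * Lloc k * (cutMulY (𝔸 := 𝔸) (h k)).restrictScalars ℝ -
        (cutMulY (𝔸 := 𝔸) (h k)).restrictScalars ℝ * ((cutMulY (𝔸 := 𝔸) (χ k)).restrictScalars ℝ * Lloc k)) * Cl k *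
        (cutMulY (𝔸 := 𝔸) (h k)).restrictScalars ℝ) =
      (mulOp (fun p : BlkY i × ι => χ k p.1) * conj b (s' • Lloc k) * mulOp (fun p : BlkY i × ι => h k p.1) -
        mulOp (fun p : BlkY i × ι => h k p.1) * (mulOp (fun p : BlkY i × ι => χ k p.1) * conj b (s' • Lloc k))) * conj b (s • Cl k) *
        mulOp (fun p : BlkY i × ι => h k p.1) :=
    fun k => conj_term3 b hs (χ k) (h k) (Lloc k) (Cl k)
  rw [Finset.sum_congr rfl fun k _ => hterm k]
  have hCl : ∀ k, HasMajorant (g := toB6 (geo9K i) Rr Hp) (fun p : BlkY i × ι => ιB p.1) (conj b (s • Cl k))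
      (fun a'' a' => B₀ * P a'' * Real.exp (-(bb * δ₀ * (geo9K i).dist a'' a'))) := fun k =>
    hasMajorant_mono (g := toB6 (geo9K i) Rr Hp) _ (hC k) fun a a' => by
      split_ifs
      · exact le_rfl
      · exact mul_nonneg (mul_nonneg hB₀ (hP a).le) (Real.exp_nonneg _)
  have h5a := B9Thm39CinvSmallSums.thirdSum_majorant_blk (g := geo9K i) (X := BlkY i × ι) (R := Rr) (H := Hp) (fun p : BlkY i × ι => ιB p.1) d' δ₀ aL αc αst ρ bb κ ℓ₀ ℓ₁ B₀ C N P
    S (fun k (p : BlkY i × ι) => χ k p.1) (fun k (p : BlkY i × ι) => h k p.1) hκ hℓ₀ hℓ₁ hB₀ hC0 hP hδ₀ hαc hρ hsplit htri hsymm hdnn hST h261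
    (fun k p => hχ1 k p.1) (fun k p => hh k p.1) (fun k p hp => hS k p.1 hp) (fun k p p' => by exact hLip k p.1 p'.1) hcnt
    (fun k => conj b (s' • Lloc k)) (fun k => conj b (s • Cl k)) hLloc hCl
  exact hasMajorant_mono (g := toB6 (geo9K i) Rr Hp) _ h5a fun a a' => le_of_eq (by ring)

end Sums

end Literature.MathematicalPhysics.QuantumFieldTheory.Balaban1983to89.B9Thm39CinvSumsY

end
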